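import Summits.BirchSwinnertonDyer.BirchSwinnertonDyer.Theorems.PrintCf2RubinValueTwoTwistedKummerScalar
import Summits.BirchSwinnertonDyer.BirchSwinnertonDyer.Theorems.PrintCf2RubinValueTwoKatoUnitRepNormRelation
import Summits.BirchSwinnertonDyer.BirchSwinnertonDyer.Theorems.PrintCf2RubinValueTwoRowTwoRelCoresKummer
import Summits.BirchSwinnertonDyer.BirchSwinnertonDyer.Theorems.PrintCf2RubinValueTwoKatoPUnitKummerRoots
import Literature.NumberTheory.ComplexMultiplication.EllipticUnits.ImaginaryQuadraticMainConjectureCarriersCores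
import Literature.NumberTheory.ComplexMultiplication.EllipticUnits.KatoLayerTwelfthRootSlack
import Literature.NumberTheory.ComplexMultiplication.EllipticUnits.KatoEllipticUnitRepresentatives
import HarnessLib

/-!
# F0b (zeta pins of `JohnsonLeungKings2011.TwistedIwasawaData`), FILE 2: laws of the twisted Kummer classes of Kato's elliptic
# units at the Kato levels `Gal(K̄/K(p^s𝔣))` — conjugates, the reduction law, and the NORM LAW (the displayed de Shalit II.2.5 relation of
# -w2 g17's (O1) read through `cor ∘ Kummer = Kummer ∘ N`)

Cell `bsd-print-cf2`, WIDTH seat `bsd-line-cf2-p1-w5` g10 (prover-bsd-line-cf2-p1-w5-g10-0); construction F0b of route C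
(`PrintCf2RubinValueTwo`), plan `HOME/bsd-line-cf2-p1-w5/F0B-ASSEMBLY-PLAN-w5g9.md` steps 2–3 (step 1 = (E) + -w2 g17's
`KatoPUnits.exists_root_isTwistedKummerClass_katoLayer`, imported); `--supports` the deciding child stmt-BirchSwinnertonDyer-24721 (helper,
Theses-free). THEOREMS ONLY (no definition, no named fact, no instance, no `sorry`). The de Shalit / Kato prints enter ONLY as displayed
hypotheses (the norm relation in the displayed shape of `KatoUnitRepNorm.exists_forall_normOver_katoUnitRep`; membership of the reps in
`katoLayer` as for `IsKatoUnitRep`). HONEST FRAMING: bookkeeping towards the EXISTENCE of ty2's pinned datum; nothing here closes the crux;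
no summit statement is proved by this seat; BSD is not proved by any of this.

WHAT (`S = suppPF p 𝔣 = {v ∣ p𝔣}`, `U_s = katoLevelSubgroup p 𝔣 s = Gal(K̄/K(p^s𝔣))`, `θ` trivial on `Gal(K̄/K(𝔣))`):
* §1 bridges: `smul_mem_katoLayer` (`K(p^s𝔣)` is `Γ_K`-stable), `apply_eq_one_of_mem_katoLevelSubgroup` (`θ|_{U_s} = 1`),
  `theta_layerArtin_eq_thetaArtin` (`θ((𝔞, K(p^s𝔣)/K)) = θ((𝔞, K(𝔣)/K)) = thetaArtin`), the standing hypotheses `hθN`/`hμN` of -w6's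
  constructor at `U_s`, and `smul_eq_self_of_isTwistedKummerClass` (a unit with a class at `U ⊇ N_S` is `N_S`-fixed);
* §2 `exists_isTwistedKummerClass_smul` — a class of the conjugate `γ•β` for any `γ ∈ Γ_K` (the class `κ(σ_𝔟 ζ) ⊗ t` of Prop. 3.3 (3));
* §3 `levelRed_eq_of_isTwistedKummerClass` — the REDUCTION LAW `red(c_{k+1}) = c_k` for roots of the same `u⁻¹`;
* §4 `relCores_eq_of_isTwistedKummerClass_of_normOver` — the NORM LAW `cor_{K(p^{s+1}𝔣)/K(p^s𝔣)} c_{s+1,k} = c_{s,k}` from the displayed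
  `N u_{s+1} = ζ·u_s`, `ζ^{12} = 1`, `s ≥ k+2` (Burungale–Flach §3.2 "the units `_𝔞z_𝔣` are norm compatible" up to Kato's 12th roots;
  `cor ∘ Kummer = Kummer ∘ N` = -w6 g8's `isTwistedKummerClass_relCores`; FILE 1 §3 with -w5 g9's twelfth-root slack).
(The iteration along `s ≤ s'` is -w2 g17's `RelCoresTower` bookkeeping; the Kato-level (Z2) identity and the assembled system follow in FILE 3.)

References: J. Johnson-Leung, G. Kings (2011) Def. 3.2, Prop. 3.3, §3.3 (5)–(6), Def. 3.5, §5.1–5.2; K. Kato, Astérisque 295 §15.5–15.6;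
A. Burungale, M. Flach (2024) §3.2; E. de Shalit (1987) II.2.4–II.2.5.
-/

noncomputable section

open scoped Classical

-- the summit namespace `Summit.BirchSwinnertonDyer.BirchSwinnertonDyer` repeats the problem name by design (D-0017)
set_option linter.dupNamespace false
set_option autoImplicit false

open scoped NumberField
open Field IsDedekindDomain IntermediateField
open Literature.NumberTheory.NumberFields (rayClassField rayClassField_mono)
open Literature.NumberTheory.GaloisRepresentations Literature.NumberTheory.GaloisRepresentations.DiscreteGaloisModule
open Literature.NumberTheory.GaloisRepresentations.LocalWeilDatum
open Literature.NumberTheory.EllipticCurves (IsImaginaryQuadratic)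
open Literature.NumberTheory.ComplexMultiplication.EllipticUnits
open Literature.NumberTheory.ComplexMultiplication.EllipticUnits.JohnsonLeungKings2011
open Summit.BirchSwinnertonDyer.BirchSwinnertonDyer.Theorems.PrintCf2.RowTwo
open Summit.BirchSwinnertonDyer.BirchSwinnertonDyer.Theorems.PrintCf2.LeopoldtAtV
open Summit.BirchSwinnertonDyer.BirchSwinnertonDyer.Theorems.PrintCf2.KatoPUnits

namespace Summit.BirchSwinnertonDyer.BirchSwinnertonDyer.Theorems.PrintCf2.TwistedZeta

variable {K : Type} [Field K] [NumberField K] (p : ℕ) [Fact p.Prime] (θ : absoluteGaloisGroup K →ₜ* ℤ_[p]ˣ)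
  (𝔣 : Ideal (𝓞 K))

/-! ## §1. Bridges: `S`-units, `Γ_K`-stability of the layers, triviality of `θ` on the Kato levels -/

omit [Fact p.Prime] in
/-- **`K(p^s𝔣)` is `Γ_K`-stable** (a normal subextension of `K̄/K`). [cite: Kato2004Asterisque, §15.1 (p. 250)] -/
theorem smul_mem_katoLayer (s : ℕ) (γ : absoluteGaloisGroup K) {x : AlgebraicClosure K} (hx : x ∈ katoLayer p 𝔣 s) :
    γ • x ∈ katoLayer p 𝔣 s :=
  (IntermediateField.normal_iff_forall_map_le'.1 (inferInstance : Normal K (katoLayer p 𝔣 s))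
    (absoluteGaloisGroup.toAlgEquiv K γ)) ⟨x, hx, rfl⟩

omit [Fact p.Prime] in
/-- Units form: `γ • u ∈ K(p^s𝔣)` for `u ∈ K(p^s𝔣)`. [cite: Kato2004Asterisque, §15.1 (p. 250)] -/
theorem smul_units_mem_katoLayer (s : ℕ) (γ : absoluteGaloisGroup K) {u : (AlgebraicClosure K)ˣ}
    (hu : (u : AlgebraicClosure K) ∈ katoLayer p 𝔣 s) : ((γ • u : (AlgebraicClosure K)ˣ) : AlgebraicClosure K) ∈ katoLayer p 𝔣 s := by
  rw [Units.coe_smul]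
  exact smul_mem_katoLayer p 𝔣 s γ hu

omit [Fact p.Prime] in
/-- `Gal(K̄/K(p^s𝔣))` fixes the units lying in `K(p^s𝔣)`. [cite: Kato2004Asterisque, §15.1 (p. 250)] -/
theorem smul_units_eq_self_of_mem_katoLevelSubgroup {s : ℕ} {σ : absoluteGaloisGroup K} (hσ : σ ∈ katoLevelSubgroup p 𝔣 s)
    {u : (AlgebraicClosure K)ˣ} (hu : (u : AlgebraicClosure K) ∈ katoLayer p 𝔣 s) : σ • u = u :=
  Units.ext (by rw [Units.coe_smul]; exact (mem_absGaloisFixingSubgroup_iff _ σ).mp hσ _ hu)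

/-- `K(𝔣) ⊆ K(p^s𝔣)`. [cite: Kato2004Asterisque, §15.1 (p. 250)] -/
theorem rayClassField_le_katoLayer (h𝔣 : 𝔣 ≠ ⊥) (s : ℕ) : rayClassField K 𝔣 ≤ katoLayer p 𝔣 s := by
  have h0 : rayClassField K 𝔣 = katoLayer p 𝔣 0 := by rw [katoLayer, katoModulus_zero]
  rw [h0]
  exact katoLayer_mono p 𝔣 h𝔣 (Nat.zero_le s)

/-- **`θ` is trivial on every Kato level `Gal(K̄/K(p^s𝔣))`** once it is trivial on `Gal(K̄/K(𝔣))` (`K(𝔣) ⊆ K(p^s𝔣)`).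
[cite: JohnsonLeungKings2011, §4.2 (arXiv p0012:L72–78: "unramified outside of p𝔣_η") and §3.3 (p0010:L63–68)] -/
theorem apply_eq_one_of_mem_katoLevelSubgroup (h𝔣 : 𝔣 ≠ ⊥)
    (hθ𝔣 : ∀ σ ∈ absGaloisFixingSubgroup (rayClassField K 𝔣), θ σ = 1) {s : ℕ} {σ : absoluteGaloisGroup K}
    (hσ : σ ∈ katoLevelSubgroup p 𝔣 s) : θ σ = 1 :=
  hθ𝔣 σ ((mem_absGaloisFixingSubgroup_iff _ σ).mpr fun x hx ↦
    (mem_absGaloisFixingSubgroup_iff _ σ).mp hσ x (rayClassField_le_katoLayer p 𝔣 h𝔣 s hx))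

/-- **`χ(σ_𝔞)` does not depend on the level**: `θ((𝔞, K(p^s𝔣)/K)) = θ((𝔞, K(𝔣)/K)) = thetaArtin` (Kato's lifts are compatible,
-w2 g17's `layerArtin_inv_mul_layerArtin_mem_of_isTwist`, and `θ` is trivial on `Gal(K̄/K(𝔣))`).
[cite: JohnsonLeungKings2011, §1.1 ("η(𝔞) = η⁻¹(σ_𝔞)", arXiv p0004:L14–24)] [cite: Kato2004Asterisque, §15.6 (p. 254)] -/
theorem theta_layerArtin_eq_thetaArtin (h𝔣 : 𝔣 ≠ ⊥)
    (hθ𝔣 : ∀ σ ∈ absGaloisFixingSubgroup (rayClassField K 𝔣), θ σ = 1) (s : ℕ) (a : AuxIdeals p 𝔣) :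
    θ (layerArtin p 𝔣 s a.1) = thetaArtin p θ 𝔣 a := by
  have h := apply_eq_one_of_mem_katoLevelSubgroup p θ 𝔣 h𝔣 hθ𝔣
    (layerArtin_inv_mul_layerArtin_mem_of_isTwist (p := p) (𝔣 := 𝔣) (Nat.zero_le s) h𝔣 a.2)
  rw [map_mul, map_inv, inv_mul_eq_one] at h
  exact h.symm

/-- `θ` is trivial on `N_S` (`N_S ≤ Gal(K̄/K(p^s𝔣))`). [cite: JohnsonLeungKings2011, §4.2 (arXiv p0012:L72–78)] -/
theorem apply_eq_one_of_mem_ramificationSubgroup (h𝔣 : 𝔣 ≠ ⊥)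
    (hθ𝔣 : ∀ σ ∈ absGaloisFixingSubgroup (rayClassField K 𝔣), θ σ = 1) {τ : absoluteGaloisGroup K}
    (hτ : τ ∈ ramificationSubgroup K (suppPF p 𝔣)) : θ τ = 1 :=
  apply_eq_one_of_mem_katoLevelSubgroup p θ 𝔣 h𝔣 hθ𝔣 (ramificationSubgroup_suppPF_le_katoLevelSubgroup p 𝔣 h𝔣 0 hτ)

/-- `N_S` fixes `μ_{p^k}` (`S ⊇ {v ∣ p}`). [cite: NeukirchSchmidtWingberg2008, VIII §3] -/
theorem smul_eq_self_of_mem_ramificationSubgroup_suppPF (k : ℕ) {τ : absoluteGaloisGroup K}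
    (hτ : τ ∈ ramificationSubgroup K (suppPF p 𝔣)) (ζ : (AlgebraicClosure K)ˣ) (hζ : ζ ^ (p ^ k) = 1) : τ • ζ = ζ :=
  smul_eq_self_of_mem_ramificationSubgroup_of_units_pow_eq_one p (suppPF p 𝔣) k (fun _ hv ↦ mem_suppPF_of_natCast_mem p 𝔣 hv) hτ ζ hζ


omit [NumberField K] in
/-- **A unit with a twisted Kummer class at a level `U ⊇ N_S` is `N_S`-fixed** (the cocycle vanishes at `1 ∈ U_S`, the image of every `τ ∈ N_S`):
recovers the «`β` is `N_S`-fixed» bookkeeping from the class itself. [cite: JohnsonLeungKings2011, §3.3 (5)–(6) (arXiv p0010:L61–70)] -/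
theorem smul_eq_self_of_isTwistedKummerClass {S : Set (HeightOneSpectrum (𝓞 K))} {U : Subgroup (absoluteGaloisGroup K)} {k : ℕ}
    (hNU : ramificationSubgroup K S ≤ U) {β : (AlgebraicClosure K)ˣ} {c : levelCoh p S θ U k 1}
    (hc : IsTwistedKummerClass p θ S U k β c) : ∀ τ ∈ ramificationSubgroup K S, τ • β = β := by
  intro τ hτ
  obtain ⟨φ, -, hφ⟩ := hc
  have h := hφ τ (hNU hτ)
  have h1 : (⟨toUnramifiedQuot K S τ, Subgroup.mem_map_of_mem _ (hNU hτ)⟩ : imGS S U) = 1 :=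
    Subtype.ext ((QuotientGroup.eq_one_iff τ).mpr hτ)
  rw [h1, contOneCocycles.apply_one, Submodule.coe_zero, muVal_zero] at h
  exact (div_eq_one.mp h.symm)

/-! ## §2. Roots and twisted Kummer classes of Kato's `p`-units at the Kato levels -/

/-- **A class of the conjugate `γ•β`** for any `γ ∈ Γ_K`, when `β` is `N_S`-fixed with `β^{p^k} ∈ K(p^s𝔣)` (so is `γ•β`: `N_S ⊴ Γ_K`,
`K(p^s𝔣)/K` normal) — the class `κ(σ_𝔟 ζ) ⊗ t` of §3.3 (5) / Prop. 3.3 (3). [cite: JohnsonLeungKings2011, §3.3 (5) and Prop. 3.3 (3) (arXiv p0009:L88–95, p0010:L61–70)] -/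
theorem exists_isTwistedKummerClass_smul (h𝔣 : 𝔣 ≠ ⊥)
    (hθ𝔣 : ∀ σ ∈ absGaloisFixingSubgroup (rayClassField K 𝔣), θ σ = 1) {s k : ℕ} (γ : absoluteGaloisGroup K)
    {β : (AlgebraicClosure K)ˣ} (hβN : ∀ τ ∈ ramificationSubgroup K (suppPF p 𝔣), τ • β = β)
    (hβs : ((β ^ (p ^ k) : (AlgebraicClosure K)ˣ) : AlgebraicClosure K) ∈ katoLayer p 𝔣 s) :
    ∃ c : levelCoh p (suppPF p 𝔣) θ (katoLevelSubgroup p 𝔣 s) k 1,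
      IsTwistedKummerClass p θ (suppPF p 𝔣) (katoLevelSubgroup p 𝔣 s) k (γ • β) c := by
  have hβ'U : ∀ σ ∈ katoLevelSubgroup p 𝔣 s, (σ • (γ • β) / (γ • β)) ^ (p ^ k) = 1 := by
    intro σ hσ
    rw [div_pow, ← smul_pow', ← smul_pow',
      smul_units_eq_self_of_mem_katoLevelSubgroup p 𝔣 hσ (smul_units_mem_katoLayer p 𝔣 s γ hβs), div_self']
  exact exists_isTwistedKummerClass p (suppPF p 𝔣) θ k (katoLevelSubgroup p 𝔣 s)
    (isOpen_absGaloisFixingSubgroup K (katoLayer p 𝔣 s))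
    (fun σ hσ ↦ apply_eq_one_of_mem_katoLevelSubgroup p θ 𝔣 h𝔣 hθ𝔣 hσ)
    (fun τ hτ ↦ apply_eq_one_of_mem_ramificationSubgroup p θ 𝔣 h𝔣 hθ𝔣 hτ)
    (fun τ hτ ζ hζ ↦ smul_eq_self_of_mem_ramificationSubgroup_suppPF p 𝔣 k hτ ζ hζ) (γ • β)
    (smul_smul_eq_of_mem_normal (ramificationSubgroup K (suppPF p 𝔣)) hβN γ) hβ'U

/-! ## §3. The reduction law -/

/-- **REDUCTION LAW** `red(c_{k+1}) = c_k`: for roots `β'^{p^{k+1}} = β^{p^k}` (of the same `u⁻¹`) and their classes at a Kato level, the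
reduction `μ_{p^{k+1}} → μ_{p^k}` of `c_{k+1}` is `c_k` (-w6 g8's `isTwistedKummerClass_levelRed`: it is a class of `β'^p`, another
`p^k`-th root of `u⁻¹`; -w6 g9's root independence). The transition maps in `k` of `lim←_k H¹(·, μ_{p^k} ⊗ θ)`.
[cite: Kato2004Asterisque, §8.2 (p. 180)] [cite: JohnsonLeungKings2011, §3.3 (5)–(6) and Cor. 3.4 (arXiv p0010:L40–70)] -/
theorem levelRed_eq_of_isTwistedKummerClass (h𝔣 : 𝔣 ≠ ⊥)
    (hθ𝔣 : ∀ σ ∈ absGaloisFixingSubgroup (rayClassField K 𝔣), θ σ = 1) {s k : ℕ} {β β' : (AlgebraicClosure K)ˣ}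
    (h : β' ^ (p ^ (k + 1)) = β ^ (p ^ k)) {c : levelCoh p (suppPF p 𝔣) θ (katoLevelSubgroup p 𝔣 s) k 1}
    {c' : levelCoh p (suppPF p 𝔣) θ (katoLevelSubgroup p 𝔣 s) (k + 1) 1}
    (hc : IsTwistedKummerClass p θ (suppPF p 𝔣) (katoLevelSubgroup p 𝔣 s) k β c)
    (hc' : IsTwistedKummerClass p θ (suppPF p 𝔣) (katoLevelSubgroup p 𝔣 s) (k + 1) β' c') :
    levelRed p (suppPF p 𝔣) θ (katoLevelSubgroup p 𝔣 s) k 1 c' = c := by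
  have h1 := isTwistedKummerClass_levelRed p (suppPF p 𝔣) θ (katoLevelSubgroup p 𝔣 s) k hc'
  exact (eq_of_isTwistedKummerClass_of_pow_eq_of_le p (suppPF p 𝔣) θ k (katoLevelSubgroup p 𝔣 s)
    (fun v hv ↦ mem_suppPF_of_natCast_mem p 𝔣 hv) (ramificationSubgroup_suppPF_le_katoLevelSubgroup p 𝔣 h𝔣 s)
    (fun σ hσ ↦ apply_eq_one_of_mem_katoLevelSubgroup p θ 𝔣 h𝔣 hθ𝔣 hσ) (β := β) (β' := β' ^ p)
    (by rw [← pow_mul, ← pow_succ', h]) hc h1).symm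

/-! ## §4. The norm law along Kato's tower -/

/-- **NORM LAW** `cor_{K(p^{s+1}𝔣)/K(p^s𝔣)} c_{s+1,k} = c_{s,k}` (`s ≥ k+2`, totally complex `K`): given reps `u ∈ K(p^s𝔣)`, `u' ∈ K(p^{s+1}𝔣)`
with the displayed norm relation `N_{K(p^{s+1}𝔣)/K(p^s𝔣)} u' = ζ·u`, `ζ^{12} = 1` (de Shalit II.2.5 / Kato (15.4.4) for Kato's reps, -w2 g17's
`KatoUnitRepNorm.exists_forall_normOver_katoUnitRep`), roots `β^{p^k} = u⁻¹`, `β'^{p^k} = u'⁻¹` and their classes: ty2's `relCores` of `c'` is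
`c`. Proof: `cor ∘ Kummer = Kummer ∘ N` (-w6 g8) makes `relCores c'` a class of `B = ∏ₓ s(x)·β'` with `B^{p^k} = (N u')⁻¹ = ζ⁻¹u⁻¹`; `ζ⁻¹ = η^{p^k}`
with `η ∈ K(p^s𝔣)` (twelfth-root slack); FILE 1 §3. [cite: BurungaleFlach2024, §3.2 (arXiv p0013:L30–36)] [cite: JohnsonLeungKings2011, Def. 3.2, Prop. 3.3 (2), Def. 3.5 (arXiv p0009:L55–95, p0010:L72–80)] [cite: Kato2004Asterisque, §15.5 (p. 253)] -/
theorem relCores_eq_of_isTwistedKummerClass_of_normOver [NumberField.IsTotallyComplex K] (h𝔣 : 𝔣 ≠ ⊥)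
    (hθ𝔣 : ∀ σ ∈ absGaloisFixingSubgroup (rayClassField K 𝔣), θ σ = 1) {s k : ℕ} (hks : k + 2 ≤ s)
    {u u' β β' : (AlgebraicClosure K)ˣ} (huF : (u : AlgebraicClosure K) ∈ katoLayer p 𝔣 s)
    (hu'F : (u' : AlgebraicClosure K) ∈ katoLayer p 𝔣 (s + 1)) {ζ : AlgebraicClosure K} (hζ : ζ ^ 12 = 1)
    (hN : ((normOver (katoLayer p 𝔣 (s + 1)) (katoLayer p 𝔣 s) ⟨(u' : AlgebraicClosure K), hu'F⟩ : katoLayer p 𝔣 (s + 1)) :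
      AlgebraicClosure K) = ζ * (u : AlgebraicClosure K))
    (hβ : β ^ (p ^ k) = u⁻¹) (hβ' : β' ^ (p ^ k) = u'⁻¹)
    {c : levelCoh p (suppPF p 𝔣) θ (katoLevelSubgroup p 𝔣 s) k 1} {c' : levelCoh p (suppPF p 𝔣) θ (katoLevelSubgroup p 𝔣 (s + 1)) k 1}
    (hc : IsTwistedKummerClass p θ (suppPF p 𝔣) (katoLevelSubgroup p 𝔣 s) k β c)
    (hc' : IsTwistedKummerClass p θ (suppPF p 𝔣) (katoLevelSubgroup p 𝔣 (s + 1)) k β' c') :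
    relCores p (suppPF p 𝔣) θ (katoLevelSubgroup_antitone p 𝔣 h𝔣 (Nat.le_succ s))
      (isOpen_absGaloisFixingSubgroup K (katoLayer p 𝔣 s)) (isOpen_absGaloisFixingSubgroup K (katoLayer p 𝔣 (s + 1))) k 1 c' = c := by
  have hp : p.Prime := Fact.out
  -- the finite coset space `U_s/U_{s+1}` and a system of representatives
  haveI : (katoLevelSubgroup p 𝔣 (s + 1)).FiniteIndex := finiteIndex_of_isOpen' (isOpen_absGaloisFixingSubgroup K _)
  letI : Fintype (↥(katoLevelSubgroup p 𝔣 s) ⧸ (katoLevelSubgroup p 𝔣 (s + 1)).subgroupOf (katoLevelSubgroup p 𝔣 s)) :=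
    Fintype.ofFinite _
  let sec : ↥(katoLevelSubgroup p 𝔣 s) ⧸ (katoLevelSubgroup p 𝔣 (s + 1)).subgroupOf (katoLevelSubgroup p 𝔣 s) →
      ↥(katoLevelSubgroup p 𝔣 s) := fun x ↦ Quotient.out x
  have hsec : ∀ x, (sec x : ↥(katoLevelSubgroup p 𝔣 s) ⧸ (katoLevelSubgroup p 𝔣 (s + 1)).subgroupOf (katoLevelSubgroup p 𝔣 s)) = x :=
    fun x ↦ QuotientGroup.out_eq' x
  have hθU : ∀ σ ∈ katoLevelSubgroup p 𝔣 s, θ σ = 1 := fun σ hσ ↦ apply_eq_one_of_mem_katoLevelSubgroup p θ 𝔣 h𝔣 hθ𝔣 hσ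
  have hrel := isTwistedKummerClass_relCores p (suppPF p 𝔣) θ k (katoLevelSubgroup_antitone p 𝔣 h𝔣 (Nat.le_succ s))
    (isOpen_absGaloisFixingSubgroup K (katoLayer p 𝔣 s)) (isOpen_absGaloisFixingSubgroup K (katoLayer p 𝔣 (s + 1)))
    (ramificationSubgroup_suppPF_le_katoLevelSubgroup p 𝔣 h𝔣 (s + 1)) hθU hsec hc'
  -- `ζ ∈ K(p^s𝔣)`, `ζ ≠ 0`, `ζ⁻¹ = η^{p^k}` with `η ∈ K(p^s𝔣)`
  have hNmem : ((normOver (katoLayer p 𝔣 (s + 1)) (katoLayer p 𝔣 s) ⟨(u' : AlgebraicClosure K), hu'F⟩ : katoLayer p 𝔣 (s + 1)) :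
      AlgebraicClosure K) ∈ katoLayer p 𝔣 s := coe_normOver_mem (katoLayer_mono p 𝔣 h𝔣 (Nat.le_succ s)) _
  have hζF : ζ ∈ katoLayer p 𝔣 s := by
    have e : ζ = ζ * (u : AlgebraicClosure K) * (u : AlgebraicClosure K)⁻¹ := by rw [mul_inv_cancel_right₀ u.ne_zero]
    rw [e, ← hN]
    exact mul_mem hNmem (inv_mem huF)
  have hζ0 : ζ ≠ 0 := by
    rintro rfl
    rw [zero_pow (by norm_num)] at hζ
    exact zero_ne_one hζ
  obtain ⟨η, hηF, hη⟩ := exists_pow_eq_of_pow_twelve_eq_one p 𝔣 h𝔣 hks (inv_mem hζF) (by rw [inv_pow, hζ, inv_one])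
  have hη0 : η ≠ 0 := by
    rintro rfl
    rw [zero_pow (pow_ne_zero _ hp.ne_zero)] at hη
    exact inv_ne_zero hζ0 hη.symm
  have hηfix : ∀ σ ∈ katoLevelSubgroup p 𝔣 s, σ • Units.mk0 η hη0 = Units.mk0 η hη0 := fun σ hσ ↦
    smul_units_eq_self_of_mem_katoLevelSubgroup p 𝔣 hσ (by rw [Units.val_mk0]; exact hηF)
  -- `∏ₓ s(x)·u' = N u' = ζ u`
  have hVs : katoLevelSubgroup p 𝔣 s = galFixing K (katoLayer p 𝔣 s) := (galFixing_eq_absGaloisFixingSubgroup _).symm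
  have hVs' : katoLevelSubgroup p 𝔣 (s + 1) = galFixing K (katoLayer p 𝔣 (s + 1)) := (galFixing_eq_absGaloisFixingSubgroup _).symm
  have hprod : ((∏ x, ((sec x : katoLevelSubgroup p 𝔣 s) : absoluteGaloisGroup K) • u' : (AlgebraicClosure K)ˣ) :
      AlgebraicClosure K) = ζ * (u : AlgebraicClosure K) := by
    rw [Units.coe_prod]
    simp only [Units.coe_smul]
    rw [prod_smul_eq_normOver_of_eq (katoLayer_mono p 𝔣 h𝔣 (Nat.le_succ s)) hVs hVs' hsec ⟨(u' : AlgebraicClosure K), hu'F⟩, hN]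
  -- the radicands: `B^{p^k} = η^{p^k} β^{p^k}`
  have hpow : (∏ x, ((sec x : katoLevelSubgroup p 𝔣 s) : absoluteGaloisGroup K) • β') ^ (p ^ k) =
      Units.mk0 η hη0 ^ (p ^ k) * β ^ (p ^ k) := by
    rw [hβ, ← Finset.prod_pow]
    simp_rw [← smul_pow', hβ', smul_inv']
    rw [Finset.prod_inv_distrib, ← Units.val_inj, Units.val_inv_eq_inv_val, hprod, Units.val_mul, Units.val_pow_eq_pow_val,
      Units.val_mk0, hη, Units.val_inv_eq_inv_val, mul_inv]
  exact eq_of_isTwistedKummerClass_of_pow_eq_pow_mul_pow p (suppPF p 𝔣) θ k (katoLevelSubgroup p 𝔣 s) hθU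
    (fun τ hτ ↦ apply_eq_one_of_mem_ramificationSubgroup p θ 𝔣 h𝔣 hθ𝔣 hτ)
    (fun τ hτ ξ hξ ↦ smul_eq_self_of_mem_ramificationSubgroup_suppPF p 𝔣 k hτ ξ hξ) hηfix hpow hrel hc


end Summit.BirchSwinnertonDyer.BirchSwinnertonDyer.Theorems.PrintCf2.TwistedZeta

end
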